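import Summits.Ventures.PercRepro.RankLevelSetRuleQModelCount
import Summits.Ventures.PercRepro.RankLevelSetRuleQModelMhat

/-!
# PercRepro — THE MODEL MATROID: `memCount = m̂` ON EVERY INDEX SET (night-1, gen 14; step 5 of `ModelRecvEq`)

On the model `T_p(U_{q,F} ⊕ U_{E∖F,E∖F})` at the tight layer (`F ⊆ E`, `#E = p + q`, `q < p`, `#F ≤ 2q`), for a member `Z ⊆ F`
of the flat and any `S` with `Z ⊆ S ⊆ E`, the members inside `S` number exactly `m̂(q, #F − q; #(S ∩ F) − q, #(S ∖ F))` — the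
bound `memCount_le_mhat` of RankLevelSetRuleQRhat is attained on the model.
* **`modelMatroid_memCount_eq_mhat`** — the statement above (RuleQModelCount's sum + RuleQModelMhat's identification).
What remains for `ModelRecvEq` (successor): the index sets of type `(a, j)` above `Z` number `C(#F − q, a)·C(#(E ∖ F), j)`, and
`ruleQRecv` regroups by type into `rhat q (p − q) (#F − q)`.  Axioms: standard.
-/

namespace PercRepro

open Set

variable {α : Type}

/-- **`memCount = m̂` on the model**: for `Z ⊆ F` with `#Z = q` and `Z ⊆ S ⊆ E`, at the tight layer with `#F ≤ 2q`,
`memCount (modelMatroid hE F q p) p q S = mhat q (#F − q) (#(S ∩ F) − q) #(S ∖ F)`. -/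
theorem modelMatroid_memCount_eq_mhat {E F : Set α} (hE : E.Finite) (hF : F ⊆ E) {q p : ℕ} (hqp : q < p)
    (hEcard : E.ncard = p + q) (hF2 : F.ncard ≤ 2 * q) {Z S : Set α} (hZF : Z ⊆ F) (hZq : Z.ncard = q)
    (hZS : Z ⊆ S) (hSE : S ⊆ E) :
    memCount (modelMatroid hE F q p) p q S = mhat q (F.ncard - q) ((S ∩ F).ncard - q) (S \ F).ncard := by
  rw [modelMatroid_memCount_eq hE hF hqp hEcard hSE]
  have hq' : q ≤ (S ∩ F).ncard := by
    rw [← hZq]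
    exact Set.ncard_le_ncard (subset_inter hZS hZF) ((hE.subset hSE).inter_of_left F)
  have hSF : (S ∩ F).ncard = q + ((S ∩ F).ncard - q) := by omega
  rw [← sum_Icc_choose_eq_mhat q (F.ncard - q) ((S ∩ F).ncard - q) (S \ F).ncard (by omega)]
  apply Finset.sum_congr rfl
  intro i _
  rw [← hSF]

end PercRepro
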